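import Summits.ResolutionOfSingularities.ResolutionOfSingularities.Theorems.FrobeniusClosingSteerBetaPolygonGauge
import Summits.ResolutionOfSingularities.ResolutionOfSingularities.Theorems.FrobeniusClosingSteerBetaPolygonFiltration
import Summits.ResolutionOfSingularities.ResolutionOfSingularities.Theorems.FrobeniusClosingSteerBetaPolygonCohenCoordinates
import Summits.ResolutionOfSingularities.ResolutionOfSingularities.Theorems.FrobeniusClosingSteerPowerSeriesParity
import HarnessLib

/-!
# Crux `Steer` (stmt-ResolutionOfSingularities-16345), chain W4.1 — hK4ⁿᶜ β-leaf TRANSPORT BRICK, part 2: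
# the threshold words are EQUIVARIANT under ring isomorphisms and, in Cohen coordinates `κ⟦X₀, X₁, X₂, X₃⟧`, are SUPPORT CONDITIONS

OURS (campaign `res-hironaka`, rung L ★L-G4, slot W4.1; seat res-L0-w41-stub-4 g7 on res-L0-w41-plan-1 RULING 172a «TRANSPORT brick GO»).
Replaces the role of no printed item; NOT a statement of the manuscript under review [claim: Hironaka2017, status: under-review];
AI-produced, weaker than expert review. Theses-free, definition-free over the TREE words `AlphaGe` / `DeltaGe` / `BetaGe`
(`…BetaPolygonWords`, p536143) and `BetaGt` (`…BetaPolygonGauge`, p540729).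

* §1 EQUIVARIANCE: for a ring isomorphism `e : S ≃+* T`, `AlphaGe x z w d ρ f ↔ AlphaGe (e x) (e z) (e w) d ρ (e f)` and likewise
  `deltaGe_map_iff`, `betaGe_map_iff`, `betaGt_map_iff` (the words are ideal memberships built from ring operations). With part 1's
  `exists_ringEquiv_mvPowerSeries_four` (Cohen coordinates `e : S ≃+* κ⟦X₀..X₃⟧`, `e x = X 0, …`) every word of an `IsHatRing`-type member is
  the same word in `κ⟦X⟧` with the VARIABLES as parameters.
* §2 GENERIC SUPPORT THEOREM `mem_iSup_span_monomial_mul_pow_iff`: in `R⟦X_σ⟧`, for cells `G k` (finite sets of exponents vanishing at two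
  variables `i₂ ≠ i₃`), `F ∈ Σ_{k ≤ d} (X^g : g ∈ G k)·(X_{i₂}, X_{i₃})^(d−k)` iff every monomial `m` of `F` has `g ≤ m` and `d − k ≤ m i₂ + m i₃`
  for some `k ≤ d`, `g ∈ G k` (⇒: supports of products; ⇐: part 1's `mem_span_monomial_iff` with the corner monomials).
* §3 THE WORDS IN COHEN COORDINATES (`x = X 0, y = X 1, z = X 2, w = X 3`, `n := d − m 2 − m 3` truncated):
  **`alphaGe_X_iff`** `AlphaGe (X 0) (X 2) (X 3) d ρ F ↔ ∀ m, coeff m F ≠ 0 → ⌈ρ·n⌉₊ ≤ m 0`;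
  **`deltaGe_X_iff`** `… ↔ ∀ m, coeff m F ≠ 0 → ⌈ρ·n⌉₊ ≤ m 0 + m 1`;
  **`betaGe_X_iff`** (`0 ≤ α`, `0 ≤ ρ`) `… ↔ ∀ m, coeff m F ≠ 0 → ⌊α·n⌋₊ + 1 ≤ m 0 ∨ (⌈α·n⌉₊ ≤ m 0 ∧ ⌈ρ·n⌉₊ ≤ m 1)`;
  **`betaGt_X_iff`** (`0 ≤ α`, `0 ≤ β`) `… ↔ ∀ m, coeff m F ≠ 0 → d ≤ m 2 + m 3 ∨ ⌊α·n⌋₊ + 1 ≤ m 0 ∨ (⌈α·n⌉₊ ≤ m 0 ∧ ⌊β·n⌋₊ + 1 ≤ m 1)`.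
  So `α(r), β(r), δ(r)` of ONE representative are read off the SUPPORT of its expansion — the currency of (C1) (`…CanonicalCleaning`,
  p543008) and of res-L0-w41-tri-2's kernel instances.

[cite: CossartJannsenSaito2020, Def. 11.1] [cite: Matsumura1987, Thm. 29.7] [folklore]
bears_on: LADDER-RESOLUTION L ★L-G4 W4.1 (crux `Steer`, binder hK4ⁿᶜ, transport for (C1) / brick I).
-/

noncomputable section

-- `Summit.<S>.<S>.…` duplicates the summit name by design (single-problem summit).
set_option linter.dupNamespace false

open IsLocalRing MvPowerSeries
open Summit.ResolutionOfSingularities.ResolutionOfSingularities.Theorems.SwitchingDichotomy.BetaPolygon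
open Summit.ResolutionOfSingularities.ResolutionOfSingularities.Theorems.SwitchingDichotomy.CanonicalCleaning
open Summit.ResolutionOfSingularities.ResolutionOfSingularities.Theorems.SwitchingDichotomy.PowerSeriesParity

namespace Summit.ResolutionOfSingularities.ResolutionOfSingularities.Theorems.SwitchingDichotomy.BetaPolygonMoves

universe u v

/-! ## §1 Equivariance of the words under ring isomorphisms -/

section Equivariance

variable {S T : Type} [CommRing S] [CommRing T] (e : S ≃+* T)

/-- Images of the building blocks of the threshold ideals under a ring isomorphism. -/
theorem map_span_pair_pow (z w : S) (d : ℕ) :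
    (Ideal.span {z, w} ^ d).map e = Ideal.span {e z, e w} ^ d := by
  rw [Ideal.map_pow, Ideal.map_span, Set.image_pair]

/-- Image of a principal ideal under a ring isomorphism. -/
theorem map_span_singleton' (a : S) : (Ideal.span {a}).map e = Ideal.span {e a} := by
  rw [Ideal.map_span, Set.image_singleton]

/-- **`AlphaGe` is equivariant under ring isomorphisms.** OURS. (folklore) -/
theorem alphaGe_map_iff (x z w : S) (d : ℕ) (ρ : ℚ) (f : S) :
    AlphaGe x z w d ρ f ↔ AlphaGe (e x) (e z) (e w) d ρ (e f) := by
  unfold AlphaGe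
  rw [← Ideal.apply_mem_of_equiv_iff (f := e), Ideal.map_sup, map_span_pair_pow]
  simp only [Ideal.map_iSup, map_span_singleton', map_mul, map_pow]

/-- **`DeltaGe` is equivariant under ring isomorphisms.** OURS. (folklore) -/
theorem deltaGe_map_iff (x y z w : S) (d : ℕ) (ρ : ℚ) (f : S) :
    DeltaGe x y z w d ρ f ↔ DeltaGe (e x) (e y) (e z) (e w) d ρ (e f) := by
  unfold DeltaGe
  rw [← Ideal.apply_mem_of_equiv_iff (f := e), Ideal.map_sup, map_span_pair_pow]
  simp only [Ideal.map_iSup, Ideal.map_mul, map_span_pair_pow, map_span_singleton', map_mul, map_pow]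

/-- **`BetaGe` is equivariant under ring isomorphisms.** OURS. (folklore) -/
theorem betaGe_map_iff (x y z w : S) (d : ℕ) (α ρ : ℚ) (f : S) :
    BetaGe x y z w d α ρ f ↔ BetaGe (e x) (e y) (e z) (e w) d α ρ (e f) := by
  unfold BetaGe
  rw [← Ideal.apply_mem_of_equiv_iff (f := e), Ideal.map_sup, map_span_pair_pow]
  simp only [Ideal.map_iSup, Ideal.map_sup, map_span_singleton', map_mul, map_pow]

/-- **`BetaGt` is equivariant under ring isomorphisms.** OURS. (folklore) -/
theorem betaGt_map_iff (x y z w : S) (d : ℕ) (α β : ℚ) (f : S) :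
    BetaGt x y z w d α β f ↔ BetaGt (e x) (e y) (e z) (e w) d α β (e f) := by
  unfold BetaGt
  rw [← Ideal.apply_mem_of_equiv_iff (f := e), Ideal.map_sup, map_span_pair_pow]
  simp only [Ideal.map_iSup, Ideal.map_sup, map_span_singleton', map_mul, map_pow]

end Equivariance


/-! ## §2 The generic support theorem for filtration ideals in `R⟦X_σ⟧` -/

section Support

variable {σ : Type} {R : Type} [CommRing R]

/-- A nonzero coefficient of a product comes from nonzero coefficients of the factors. -/
theorem exists_coeff_ne_zero_of_coeff_mul_ne_zero (φ ψ : MvPowerSeries σ R) {m : σ →₀ ℕ}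
    (h : coeff m (φ * ψ) ≠ 0) : ∃ a b : σ →₀ ℕ, a + b = m ∧ coeff a φ ≠ 0 ∧ coeff b ψ ≠ 0 := by
  classical
  rw [coeff_mul] at h
  by_contra hne
  push Not at hne
  refine h (Finset.sum_eq_zero fun q hq => ?_)
  replace hq := Finset.HasAntidiagonal.mem_antidiagonal.mp hq
  by_cases ha : coeff q.1 φ = 0
  · rw [ha, zero_mul]
  · rw [hne q.1 q.2 hq ha, mul_zero]

/-- The series supported on an up-set `U` of exponents form an IDEAL (existence form, no new definition). -/
theorem exists_ideal_mem_iff_coeff_eq_zero {U : Set (σ →₀ ℕ)} (hU : ∀ ⦃m m' : σ →₀ ℕ⦄, m ∈ U → m ≤ m' → m' ∈ U) :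
    ∃ J : Ideal (MvPowerSeries σ R), ∀ F, F ∈ J ↔ ∀ m ∉ U, coeff m F = 0 :=
  ⟨{ carrier := {G | ∀ m ∉ U, coeff m G = 0}
     add_mem' := fun {a b} ha hb m hm => by rw [map_add, ha m hm, hb m hm, add_zero]
     zero_mem' := fun m _ => by simp
     smul_mem' := fun c a ha m hm => by
       rw [smul_eq_mul]; exact coeff_mul_eq_zero_of_forall_coeff_eq_zero hU c ha hm }, fun _ => Iff.rfl⟩

variable [Fintype σ] [DecidableEq σ]

omit [Fintype σ] in
/-- The pair ideal `(X a, X b)` is the ideal of the variable set `{a, b}`. -/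
theorem span_X_pair_eq (a b : σ) :
    Ideal.span ({X a, X b} : Set (MvPowerSeries σ R)) =
      Ideal.span ((fun s : σ => (X s : MvPowerSeries σ R)) '' (({a, b} : Finset σ) : Set σ)) := by
  rw [Finset.coe_pair, Set.image_pair]

/-- `φ ∈ (X a, X b)^n ↔ every monomial of φ has `m a + m b ≥ n`** (`a ≠ b`; res-D-pv-007's `mem_pow_span_X_iff`). -/
theorem mem_span_X_pair_pow_iff {a b : σ} (hab : a ≠ b) (n : ℕ) (φ : MvPowerSeries σ R) :
    φ ∈ Ideal.span ({X a, X b} : Set (MvPowerSeries σ R)) ^ n ↔ ∀ m : σ →₀ ℕ, coeff m φ ≠ 0 → n ≤ m a + m b := by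
  rw [span_X_pair_eq, mem_pow_span_X_iff]
  simp only [Finset.sum_pair hab]

/-- **GENERIC SUPPORT THEOREM.** In `R⟦X_σ⟧`, for cells `G k` (finite sets of exponents vanishing at the two variables `i₂ ≠ i₃`),
`F ∈ Σ_{k ≤ d} (X^g : g ∈ G k)·(X_{i₂}, X_{i₃})^(d−k)` iff EVERY MONOMIAL `m` of `F` satisfies `g ≤ m` and `d − k ≤ m i₂ + m i₃` for some
`k ≤ d`, `g ∈ G k`. OURS. (folklore) -/
theorem mem_iSup_span_monomial_mul_pow_iff (G : ℕ → Finset (σ →₀ ℕ)) {i₂ i₃ : σ} (hne : i₂ ≠ i₃)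
    (hG : ∀ k, ∀ g ∈ G k, g i₂ = 0 ∧ g i₃ = 0) (d : ℕ) (F : MvPowerSeries σ R) :
    F ∈ ⨆ (k : ℕ) (_ : k ≤ d), Ideal.span ((fun g => monomial g (1 : R)) '' (G k : Set (σ →₀ ℕ))) *
        Ideal.span ({X i₂, X i₃} : Set (MvPowerSeries σ R)) ^ (d - k) ↔
      ∀ m : σ →₀ ℕ, coeff m F ≠ 0 → ∃ k ≤ d, ∃ g ∈ G k, g ≤ m ∧ d - k ≤ m i₂ + m i₃ := by
  classical
  -- the up-set and its ideal
  set U : Set (σ →₀ ℕ) := {m | ∃ k ≤ d, ∃ g ∈ G k, g ≤ m ∧ d - k ≤ m i₂ + m i₃} with hUdef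
  have hU : ∀ ⦃m m' : σ →₀ ℕ⦄, m ∈ U → m ≤ m' → m' ∈ U := by
    rintro m m' ⟨k, hk, g, hg, hgm, hdk⟩ hmm'
    exact ⟨k, hk, g, hg, hgm.trans hmm', hdk.trans (add_le_add (hmm' i₂) (hmm' i₃))⟩
  obtain ⟨J, hJ⟩ := exists_ideal_mem_iff_coeff_eq_zero (R := R) hU
  constructor
  · -- `⨆ ≤ J`
    intro hF
    have hle : (⨆ (k : ℕ) (_ : k ≤ d), Ideal.span ((fun g => monomial g (1 : R)) '' (G k : Set (σ →₀ ℕ))) *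
        Ideal.span ({X i₂, X i₃} : Set (MvPowerSeries σ R)) ^ (d - k)) ≤ J := by
      refine iSup₂_le fun k hk => Ideal.mul_le.mpr fun r hr s hs => (hJ _).mpr fun m hm => ?_
      rw [mem_span_monomial_iff] at hr
      rw [mem_span_X_pair_pow_iff hne] at hs
      by_contra hrs
      obtain ⟨a, b, hab, ha, hb⟩ := exists_coeff_ne_zero_of_coeff_mul_ne_zero r s hrs
      obtain ⟨g, hg, hga⟩ := hr a ha
      refine hm ⟨k, hk, g, hg, hga.trans (hab ▸ le_add_right le_rfl), (hs b hb).trans ?_⟩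
      rw [← hab]
      exact add_le_add le_add_self le_add_self
    intro m hm
    by_contra hmU
    exact hm (((hJ F).mp (hle hF)) m hmU)
  · -- corner monomials
    intro h
    let E : Finset (σ →₀ ℕ) := (Finset.range (d + 1)).biUnion fun k => (G k).biUnion fun g =>
      (Finset.range (d - k + 1)).image fun i => g + Finsupp.single i₂ i + Finsupp.single i₃ (d - k - i)
    have hEle : Ideal.span ((fun g => monomial g (1 : R)) '' (E : Set (σ →₀ ℕ))) ≤
        ⨆ (k : ℕ) (_ : k ≤ d), Ideal.span ((fun g => monomial g (1 : R)) '' (G k : Set (σ →₀ ℕ))) *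
          Ideal.span ({X i₂, X i₃} : Set (MvPowerSeries σ R)) ^ (d - k) := by
      rw [Ideal.span_le]
      rintro _ ⟨ε, hε, rfl⟩
      simp only [E, Finset.coe_biUnion, Finset.coe_image, Finset.mem_coe, Set.mem_iUnion, Set.mem_image,
        Finset.mem_range] at hε
      obtain ⟨k, hk, g, hg, i, hi, rfl⟩ := hε
      have hmono : (monomial (g + Finsupp.single i₂ i + Finsupp.single i₃ (d - k - i)) (1 : R) : MvPowerSeries σ R)
          = monomial g 1 * (X i₂ ^ i * X i₃ ^ (d - k - i)) := by
        rw [X_pow_eq, X_pow_eq, monomial_mul_monomial, monomial_mul_monomial, one_mul, one_mul, add_assoc]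
      have hzw : (X i₂ : MvPowerSeries σ R) ^ i * X i₃ ^ (d - k - i) ∈
          Ideal.span ({X i₂, X i₃} : Set (MvPowerSeries σ R)) ^ (d - k) := by
        have := pow_mul_pow_mem_span_pair_pow (X i₂ : MvPowerSeries σ R) (X i₃) i (d - k - i)
        rwa [show i + (d - k - i) = d - k by omega] at this
      rw [SetLike.mem_coe]
      change (monomial (g + Finsupp.single i₂ i + Finsupp.single i₃ (d - k - i)) (1 : R) : MvPowerSeries σ R) ∈ _
      rw [hmono]
      exact Submodule.mem_iSup_of_mem k (Submodule.mem_iSup_of_mem (Nat.lt_succ_iff.mp hk)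
        (Ideal.mul_mem_mul (Ideal.subset_span ⟨g, hg, rfl⟩) hzw))
    refine hEle ((mem_span_monomial_iff E F).mpr fun m hm => ?_)
    obtain ⟨k, hk, g, hg, hgm, hdk⟩ := h m hm
    obtain ⟨hg2, hg3⟩ := hG k g hg
    set i := min (m i₂) (d - k) with hi
    have hi1 : i ≤ m i₂ := Nat.min_le_left _ _
    have hi2 : i ≤ d - k := Nat.min_le_right _ _
    have hi3 : m i₂ ≤ i ∨ d - k ≤ i := by
      rcases le_total (m i₂) (d - k) with h | h
      · exact Or.inl (by rw [hi, min_eq_left h])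
      · exact Or.inr (by rw [hi, min_eq_right h])
    refine ⟨g + Finsupp.single i₂ i + Finsupp.single i₃ (d - k - i), ?_, ?_⟩
    · simp only [E, Finset.mem_biUnion, Finset.mem_range, Finset.mem_image]
      exact ⟨k, Nat.lt_succ_of_le hk, g, hg, i, Nat.lt_succ_of_le hi2, rfl⟩
    · intro t
      simp only [Finsupp.coe_add, Pi.add_apply, Finsupp.single_apply]
      by_cases ht2 : i₂ = t
      · subst ht2
        rw [if_pos rfl, if_neg hne.symm, hg2]; omega
      · by_cases ht3 : i₃ = t
        · subst ht3
          rw [if_neg ht2, if_pos rfl, hg3]; omega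
        · rw [if_neg ht2, if_neg ht3, add_zero, add_zero]; exact hgm t

end Support


/-! ## §3 The words in Cohen coordinates `x = X 0`, `y = X 1`, `z = X 2`, `w = X 3` -/

section Instances

variable {σ : Type} {R : Type} [CommRing R]

/-- `single a t + single b u ≤ m ↔ t ≤ m a ∧ u ≤ m b` for `a ≠ b`. -/
theorem single_add_single_le_iff {a b : σ} (hab : a ≠ b) (t u : ℕ) (m : σ →₀ ℕ) :
    Finsupp.single a t + Finsupp.single b u ≤ m ↔ t ≤ m a ∧ u ≤ m b := by
  classical
  constructor
  · intro h
    have ha := h a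
    have hb := h b
    simp only [Finsupp.coe_add, Pi.add_apply, Finsupp.single_eq_same, Finsupp.single_eq_of_ne hab,
      Finsupp.single_eq_of_ne (Ne.symm hab), add_zero, zero_add] at ha hb
    exact ⟨ha, hb⟩
  · rintro ⟨ha, hb⟩ c
    simp only [Finsupp.coe_add, Pi.add_apply, Finsupp.single_apply]
    split_ifs with h1 h2 h2
    · exact absurd (h1.trans h2.symm) hab
    · subst h1; simpa using ha
    · subst h2; simpa using hb
    · simp

/-- The threshold arithmetic behind `α` / `δ`: `(∃ k ≤ d, ⌈ρk⌉ ≤ a ∧ d − k ≤ s) ↔ ⌈ρ (d − s)⌉ ≤ a`. -/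
theorem exists_ceil_le_iff (ρ : ℚ) (d s a : ℕ) :
    (∃ k, k ≤ d ∧ ⌈ρ * (k : ℚ)⌉₊ ≤ a ∧ d - k ≤ s) ↔ ⌈ρ * ((d - s : ℕ) : ℚ)⌉₊ ≤ a := by
  constructor
  · rintro ⟨k, hkd, hk, hks⟩
    rcases le_or_gt 0 ρ with hρ | hρ
    · refine le_trans (Nat.ceil_mono (mul_le_mul_of_nonneg_left ?_ hρ)) hk
      exact_mod_cast (show d - s ≤ k by omega)
    · rw [Nat.ceil_eq_zero.mpr (mul_nonpos_of_nonpos_of_nonneg hρ.le (by positivity))]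
      exact Nat.zero_le _
  · intro h
    exact ⟨d - s, Nat.sub_le d s, h, by omega⟩

/-- A monomial with an `x`-power in front: `(x^c · z^i · w^j) = (X^(single 0 c)) · (z^i w^j)` as ideals. -/
theorem span_X_pow_mul_eq (c i j : ℕ) :
    Ideal.span {(X 0 : MvPowerSeries (Fin 4) R) ^ c * X 2 ^ i * X 3 ^ j} =
      Ideal.span ((fun g => monomial g (1 : R)) '' ((({Finsupp.single 0 c} : Finset (Fin 4 →₀ ℕ))) : Set _)) *
        Ideal.span {(X 2 : MvPowerSeries (Fin 4) R) ^ i * X 3 ^ j} := by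
  rw [Finset.coe_singleton, Set.image_singleton, Ideal.span_singleton_mul_span_singleton, mul_assoc, X_pow_eq]

/-- The zeroth `α`-cell is everything. -/
theorem span_monomial_single_zero :
    Ideal.span ((fun g => monomial g (1 : R)) '' ((({Finsupp.single (0 : Fin 4) 0} : Finset (Fin 4 →₀ ℕ))) : Set _)) =
      (⊤ : Ideal (MvPowerSeries (Fin 4) R)) := by
  rw [Finset.coe_singleton, Set.image_singleton, Finsupp.single_zero, monomial_zero_one, Ideal.span_singleton_one]

/-- **`α ≥ ρ` IN COHEN COORDINATES is a support condition**: `AlphaGe (X 0) (X 2) (X 3) d ρ F` iff every monomial `m` of `F` has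
`⌈ρ · (d − m 2 − m 3)⌉ ≤ m 0` (`d − m 2 − m 3` truncated at `0`). OURS. (folklore) -/
theorem alphaGe_X_iff (d : ℕ) (ρ : ℚ) (F : MvPowerSeries (Fin 4) R) :
    AlphaGe (X 0) (X 2) (X 3) d ρ F ↔ ∀ m : Fin 4 →₀ ℕ, coeff m F ≠ 0 → ⌈ρ * ((d - m 2 - m 3 : ℕ) : ℚ)⌉₊ ≤ m 0 := by
  classical
  unfold AlphaGe
  simp_rw [span_X_pow_mul_eq]
  have hC0 : Ideal.span ((fun g => monomial g (1 : R)) ''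
      ((({Finsupp.single (0 : Fin 4) ⌈ρ * ((0 : ℕ) : ℚ)⌉₊} : Finset (Fin 4 →₀ ℕ))) : Set _)) =
        (⊤ : Ideal (MvPowerSeries (Fin 4) R)) := by
    rw [Nat.cast_zero, mul_zero, Nat.ceil_zero, span_monomial_single_zero]
  have key := sup_iSup_eq_iSup_mul_pow (S := MvPowerSeries (Fin 4) R)
    (C := fun k => Ideal.span ((fun g => monomial g (1 : R)) ''
      ((({Finsupp.single (0 : Fin 4) ⌈ρ * (k : ℚ)⌉₊} : Finset (Fin 4 →₀ ℕ))) : Set _))) hC0 (X 2) (X 3) d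
  rw [key, mem_iSup_span_monomial_mul_pow_iff (fun k => {Finsupp.single (0 : Fin 4) ⌈ρ * (k : ℚ)⌉₊})
    (show (2 : Fin 4) ≠ 3 by decide) ?_ d F]
  · refine forall₂_congr fun m _ => ?_
    simp only [Finset.mem_singleton, exists_eq_left, Finsupp.single_le_iff]
    rw [Nat.sub_sub]
    exact exists_ceil_le_iff ρ d (m 2 + m 3) (m 0)
  · intro k g hg
    rw [Finset.mem_singleton] at hg
    subst hg
    simp

/-- `(X a, X b)^c` is the span of the monomials `X a ^ t · X b ^ (c − t)`. -/
theorem span_X_pair_pow_eq [Fintype σ] [DecidableEq σ] {a b : σ} (hab : a ≠ b) (c : ℕ) :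
    Ideal.span ({X a, X b} : Set (MvPowerSeries σ R)) ^ c =
      Ideal.span ((fun g => monomial g (1 : R)) ''
        ((((Finset.range (c + 1)).image fun t => Finsupp.single a t + Finsupp.single b (c - t)) : Finset (σ →₀ ℕ)) :
          Set (σ →₀ ℕ))) := by
  ext φ
  rw [mem_span_X_pair_pow_iff hab, mem_span_monomial_iff]
  refine forall₂_congr fun m _ => ?_
  constructor
  · intro h
    refine ⟨Finsupp.single a (min c (m a)) + Finsupp.single b (c - min c (m a)), ?_, ?_⟩
    · exact Finset.mem_image.mpr ⟨min c (m a), Finset.mem_range.mpr (by omega), rfl⟩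
    · rw [single_add_single_le_iff hab]
      exact ⟨Nat.min_le_right _ _, by omega⟩
  · rintro ⟨g, hg, hgm⟩
    obtain ⟨t, ht, rfl⟩ := Finset.mem_image.mp hg
    rw [single_add_single_le_iff hab] at hgm
    rw [Finset.mem_range] at ht
    omega

/-- **`δ ≥ ρ` IN COHEN COORDINATES**: `DeltaGe (X 0) (X 1) (X 2) (X 3) d ρ F` iff every monomial `m` of `F` has
`⌈ρ · (d − m 2 − m 3)⌉ ≤ m 0 + m 1`. OURS. (folklore) -/
theorem deltaGe_X_iff (d : ℕ) (ρ : ℚ) (F : MvPowerSeries (Fin 4) R) :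
    DeltaGe (X 0) (X 1) (X 2) (X 3) d ρ F ↔
      ∀ m : Fin 4 →₀ ℕ, coeff m F ≠ 0 → ⌈ρ * ((d - m 2 - m 3 : ℕ) : ℚ)⌉₊ ≤ m 0 + m 1 := by
  classical
  unfold DeltaGe
  simp_rw [span_X_pair_pow_eq (R := R) (show (0 : Fin 4) ≠ 1 by decide)]
  set G : ℕ → Finset (Fin 4 →₀ ℕ) := fun k =>
    (Finset.range (⌈ρ * (k : ℚ)⌉₊ + 1)).image fun t => Finsupp.single 0 t + Finsupp.single 1 (⌈ρ * (k : ℚ)⌉₊ - t) with hGdef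
  have hC0 : Ideal.span ((fun g => monomial g (1 : R)) '' ((G 0 : Finset (Fin 4 →₀ ℕ)) : Set _)) =
      (⊤ : Ideal (MvPowerSeries (Fin 4) R)) := by
    have : G 0 = {0} := by
      simp only [hGdef, Nat.cast_zero, mul_zero, Nat.ceil_zero, zero_add, Finset.range_one, Finset.image_singleton,
        Nat.sub_self, Finsupp.single_zero, add_zero]
    rw [this, Finset.coe_singleton, Set.image_singleton, monomial_zero_one, Ideal.span_singleton_one]
  have key := sup_iSup_eq_iSup_mul_pow (S := MvPowerSeries (Fin 4) R)
    (C := fun k => Ideal.span ((fun g => monomial g (1 : R)) '' ((G k : Finset (Fin 4 →₀ ℕ)) : Set _))) hC0 (X 2) (X 3) d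
  rw [key, mem_iSup_span_monomial_mul_pow_iff G (show (2 : Fin 4) ≠ 3 by decide) ?_ d F]
  · refine forall₂_congr fun m _ => ?_
    rw [Nat.sub_sub, ← exists_ceil_le_iff ρ d (m 2 + m 3) (m 0 + m 1)]
    refine exists_congr fun k => and_congr_right fun _ => ?_
    constructor
    · rintro ⟨g, hg, hgm, hdk⟩
      obtain ⟨t, ht, rfl⟩ := Finset.mem_image.mp hg
      rw [single_add_single_le_iff (show (0 : Fin 4) ≠ 1 by decide)] at hgm
      rw [Finset.mem_range] at ht
      exact ⟨by omega, hdk⟩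
    · rintro ⟨hk, hdk⟩
      refine ⟨Finsupp.single 0 (min ⌈ρ * (k : ℚ)⌉₊ (m 0)) +
          Finsupp.single 1 (⌈ρ * (k : ℚ)⌉₊ - min ⌈ρ * (k : ℚ)⌉₊ (m 0)), ?_, ?_, hdk⟩
      · exact Finset.mem_image.mpr ⟨_, Finset.mem_range.mpr (by omega), rfl⟩
      · rw [single_add_single_le_iff (show (0 : Fin 4) ≠ 1 by decide)]
        exact ⟨Nat.min_le_right _ _, by omega⟩
  · intro k g hg
    obtain ⟨t, _, rfl⟩ := Finset.mem_image.mp hg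
    simp

end Instances

end Summit.ResolutionOfSingularities.ResolutionOfSingularities.Theorems.SwitchingDichotomy.BetaPolygonMoves

end
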